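import Literature.Probability.RandomPlanarGeometry.BrownianExitIntervalTail
import Literature.Probability.RandomPlanarGeometry.BrownianStrongMarkov
import Literature.Probability.RandomPlanarGeometry.PathExitFunctionals
import HarnessLib

/-!
# The Brownian exit problem on path space, and the strong Markov property at the exit time

Topic `Probability/RandomPlanarGeometry` (support file for the Skorokhod embedding,
Lawler–Schramm–Werner (2004), Lemma 3.8 / Durrett (2019), Thms. 8.1.1, 8.2.1). Everything here is
PROVED; no named fact is introduced.

We push the canonical Brownian motion to the path space `C([0, ∞), ℝ)`:
`brownianPathC ω = (t ↦ B_t(ω))`, with law `wienerLawC` (the Wiener measure on `C(ℝ≥0, ℝ)`),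
and record, for levels `a < 0 < b`:

* the **dictionary** between the Brownian exit quantities of `BrownianExitInterval` and the path
  functionals of `PathExitFunctionals` (`exitTime_brownian_eq_pathExitTime` etc., definitional),
  and between the post-exit increments `brownianIncrAfter` of `BrownianStrongMarkov` and
  `postExitPath` (`brownianIncrAfter_exitTime_eq_postExitPath`);
* the **exit facts under the Wiener law**: a.s. the path exits `(a, b)` at an endpoint, the
  exit probabilities `b/(b-a)`, `-a/(b-a)` (`wienerLawC_real_exitLeft/Right`), hence
  `∫ f(exit value) = (b f(a) - a f(b))/(b - a)` (`integral_comp_pathExitValue_wienerLawC`),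
  `E[T] = -ab = E[p(T)²]`, `E[T - p(T)²] = 0` (`integral_pathExitTimeReal_sub_sq_wienerLawC`),
  `E[T²] ≤ 2/(1-θ₀)² (b-a)⁴` (`integral_pathExitTimeReal_sq_wienerLawC_le`);
* the **strong Markov property at the exit time, on path space** (from `BrownianStrongMarkov`,
  Le Gall (2016), Thm. 2.20, at the a.s. finite stopping time `T_{a,b}`): under `wienerLawC` the
  post-exit path `postExitPath a b` has law `wienerLawC` (`map_postExitPath_wienerLawC`) and is
  independent of the pair (exit time, pre-exit path)
  (`indepFun_postExitPath_wienerLawC`) — the form iterated by the Skorokhod embedding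
  (Durrett (2019), proof of Thm. 8.2.1: "`{B(T_{k-1} + t) - B(T_{k-1})}` is a Brownian motion
  independent of `𝓕(T_{k-1})`").

## References

* R. Durrett, *Probability: Theory and Examples*, 5th ed. (2019), Thms. 7.5.3, 7.5.5, 8.1.1, 8.2.1.
* J.-F. Le Gall, *Brownian Motion, Martingales, and Stochastic Calculus* (2016), Thm. 2.20.
* G. F. Lawler, O. Schramm, W. Werner, Ann. Probab. 32 (2004), Lemma 3.8.
-/

noncomputable section

open MeasureTheory ProbabilityTheory Filter Set
open scoped NNReal ENNReal Topology

namespace Literature.Probability.RandomPlanarGeometry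

open Literature.Probability.Process

variable {a b : ℝ}

/-! ### The Brownian path as a random element of `C(ℝ≥0, ℝ)` -/

/-- The **canonical Brownian path** `ω ↦ (t ↦ B_t(ω))` as an element of `C([0, ∞), ℝ)` (paths of
`Process.brownian` are continuous by construction). Billingsley (1999), §7. [folklore] -/
def brownianPathC : (ℝ≥0 → ℝ) → C(ℝ≥0, ℝ) :=
  toPathC Process.brownian Process.continuous_brownian

/-- Unfolding of the Brownian path. [folklore] -/
@[simp] theorem brownianPathC_apply (ω : ℝ≥0 → ℝ) (t : ℝ≥0) :
    brownianPathC ω t = Process.brownian t ω := rfl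

/-- The Brownian path starts at `0`. [folklore] -/
theorem brownianPathC_apply_zero (ω : ℝ≥0 → ℝ) : brownianPathC ω 0 = 0 := by
  simp [Process.brownian_zero]

/-- **Dictionary, exit time**: the Brownian exit time of `(a, b)` is the path exit time of the
Brownian path (definitional). [folklore] -/
theorem exitTime_brownian_eq_pathExitTime (a b : ℝ) (ω : ℝ≥0 → ℝ) :
    Process.exitTime Process.brownian a b ω = pathExitTime a b (brownianPathC ω) := rfl

/-- **Dictionary, exit value** (definitional). [folklore] -/
theorem brownianExitValue_eq_pathExitValue (a b : ℝ) (ω : ℝ≥0 → ℝ) :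
    brownianExitValue a b ω = pathExitValue a b (brownianPathC ω) := rfl

/-- **Dictionary, real exit time** (definitional). [folklore] -/
theorem brownianExitTimeReal_eq_pathExitTimeReal (a b : ℝ) (ω : ℝ≥0 → ℝ) :
    brownianExitTimeReal a b ω = pathExitTimeReal a b (brownianPathC ω) := rfl

/-- **Dictionary, post-exit increments**: the Brownian increments after the exit time
(`brownianIncrAfter` of `BrownianStrongMarkov`) form the post-exit path of the Brownian path
(definitional, including the junk conventions). [folklore] -/
theorem brownianIncrAfter_exitTime_eq_postExitPath (a b : ℝ) (ω : ℝ≥0 → ℝ) (u : ℝ≥0) :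
    brownianIncrAfter (Process.exitTime Process.brownian a b) u ω =
      postExitPath a b (brownianPathC ω) u := rfl

/-- **Dictionary, stopped path**: the Brownian path stopped at the exit time is the pre-exit
path of the Brownian path (definitional). [folklore] -/
theorem stoppedProcess_brownian_eq_preExitPath (a b : ℝ) (t : ℝ≥0) (ω : ℝ≥0 → ℝ) :
    stoppedProcess Process.brownian (Process.exitTime Process.brownian a b) t ω =
      preExitPath a b (brownianPathC ω) t := rfl

section PathLaw

variable [MeasurableSpace C(ℝ≥0, ℝ)] [BorelSpace C(ℝ≥0, ℝ)]

/-- The Brownian path is a measurable random element of `C(ℝ≥0, ℝ)`. [folklore] -/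
theorem measurable_brownianPathC : Measurable brownianPathC :=
  measurable_toPathC Process.continuous_brownian Process.measurable_brownian

/-- The **Wiener law on `C([0, ∞), ℝ)`**: the law of the canonical Brownian path. Billingsley
(1999), §7 (Wiener measure on `C`). [folklore] -/
def wienerLawC : Measure C(ℝ≥0, ℝ) := Process.preWienerMeasure.map brownianPathC

/-- The Wiener law is a probability measure. [folklore] -/
instance isProbabilityMeasure_wienerLawC : IsProbabilityMeasure (wienerLawC) := by
  haveI := isProbabilityMeasure_preWienerMeasure'
  exact Measure.isProbabilityMeasure_map measurable_brownianPathC.aemeasurable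

/-- Integration against the Wiener law is integration over the pre-Wiener space along the
Brownian path. [folklore] -/
theorem integral_wienerLawC {f : C(ℝ≥0, ℝ) → ℝ} (hf : AEStronglyMeasurable f wienerLawC) :
    ∫ p, f p ∂wienerLawC = ∫ ω, f (brownianPathC ω) ∂Process.preWienerMeasure :=
  integral_map measurable_brownianPathC.aemeasurable hf

/-- Probabilities under the Wiener law are probabilities of the Brownian path. [folklore] -/
theorem wienerLawC_apply {s : Set C(ℝ≥0, ℝ)} (hs : MeasurableSet s) :
    wienerLawC s = Process.preWienerMeasure (brownianPathC ⁻¹' s) :=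
  Measure.map_apply measurable_brownianPathC hs

/-- Almost sure statements transfer from the pre-Wiener space to the Wiener law. [folklore] -/
theorem ae_wienerLawC_iff {p : C(ℝ≥0, ℝ) → Prop} (hp : MeasurableSet {x | p x}) :
    (∀ᵐ x ∂wienerLawC, p x) ↔ ∀ᵐ ω ∂Process.preWienerMeasure, p (brownianPathC ω) :=
  ae_map_iff measurable_brownianPathC.aemeasurable hp

/-- Wiener-almost every path starts at `0`. [folklore] -/
theorem ae_apply_zero_eq_zero_wienerLawC : ∀ᵐ p ∂wienerLawC, p 0 = 0 := by
  rw [ae_wienerLawC_iff]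
  · exact ae_of_all _ brownianPathC_apply_zero
  · exact measurable_coordProcess 0 (measurableSet_singleton 0)

/-! ### The exit facts under the Wiener law -/

/-- **Wiener-a.e. path exits `(a, b)`** (`a < 0 < b`). Durrett (2019), Thm. 7.5.3 (`T < ∞` a.s.).
[cite: Durrett2019, Thm. 7.5.3] -/
theorem ae_pathExitTime_ne_top_wienerLawC (ha : a < 0) (hb : 0 < b) :
    ∀ᵐ p ∂wienerLawC, pathExitTime a b p ≠ ⊤ := by
  rw [ae_wienerLawC_iff (p := fun x ↦ pathExitTime a b x ≠ ⊤)
    (measurableSet_pathExitTime_eq_top a b).compl]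
  exact ae_exitTime_brownian_ne_top ha hb

/-- **Wiener-a.e. path exits `(a, b)` at an endpoint** (`a < 0 < b`): the exit time is finite and
the exit value is `a` or `b`. [folklore] -/
theorem ae_pathExitValue_eq_or_eq_wienerLawC (ha : a < 0) (hb : 0 < b) :
    ∀ᵐ p ∂wienerLawC, pathExitTime a b p ≠ ⊤ ∧ (pathExitValue a b p = a ∨ pathExitValue a b p = b) := by
  filter_upwards [ae_pathExitTime_ne_top_wienerLawC ha hb, ae_apply_zero_eq_zero_wienerLawC]
    with p hp h0
  exact ⟨hp, pathExitValue_eq_or_eq (by rw [h0]; exact ⟨ha, hb⟩) hp⟩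

/-- The left exit event on path space is measurable. [folklore] -/
theorem measurableSet_pathExitLeft (a b : ℝ) :
    MeasurableSet {p : C(ℝ≥0, ℝ) | pathExitTime a b p ≠ ⊤ ∧ pathExitValue a b p = a} :=
  (measurableSet_pathExitTime_eq_top a b).compl.inter
    (measurable_pathExitValue a b (measurableSet_singleton a))

/-- The right exit event on path space is measurable. [folklore] -/
theorem measurableSet_pathExitRight (a b : ℝ) :
    MeasurableSet {p : C(ℝ≥0, ℝ) | pathExitTime a b p ≠ ⊤ ∧ pathExitValue a b p = b} :=
  (measurableSet_pathExitTime_eq_top a b).compl.inter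
    (measurable_pathExitValue a b (measurableSet_singleton b))

/-- **Gambler's ruin under the Wiener law, left exit**: `P[exit (a,b) at a] = b/(b-a)`
(`a < 0 < b`). Durrett (2019), Thm. 7.5.3. [cite: Durrett2019, Thm. 7.5.3] -/
theorem wienerLawC_real_exitLeft (ha : a < 0) (hb : 0 < b) :
    wienerLawC.real {p | pathExitTime a b p ≠ ⊤ ∧ pathExitValue a b p = a} = b / (b - a) := by
  rw [measureReal_def, wienerLawC_apply (measurableSet_pathExitLeft a b), ← measureReal_def]
  exact measureReal_brownianExitLeft ha hb

/-- **Gambler's ruin under the Wiener law, right exit**: `P[exit (a,b) at b] = -a/(b-a)`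
(`a < 0 < b`). Durrett (2019), Thm. 7.5.3. [cite: Durrett2019, Thm. 7.5.3] -/
theorem wienerLawC_real_exitRight (ha : a < 0) (hb : 0 < b) :
    wienerLawC.real {p | pathExitTime a b p ≠ ⊤ ∧ pathExitValue a b p = b} = -a / (b - a) := by
  rw [measureReal_def, wienerLawC_apply (measurableSet_pathExitRight a b), ← measureReal_def]
  exact measureReal_brownianExitRight ha hb

/-- **The exit distribution integrates test functions by the two-point formula**
(`a < 0 < b`): `∫ f(p(T)) dW = (b f(a) - a f(b))/(b - a)`. This is the pair average of
`SkorokhodSelection` (`μ_{a,b}({a}) = b/(b-a)`, `μ_{a,b}({b}) = -a/(b-a)`, Durrett (2019),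
proof of Thm. 8.1.1). [cite: Durrett2019, Thm. 8.1.1] -/
theorem integral_comp_pathExitValue_wienerLawC (ha : a < 0) (hb : 0 < b) (f : ℝ → ℝ) :
    ∫ p, f (pathExitValue a b p) ∂wienerLawC = (b * f a - a * f b) / (b - a) := by
  set L := {p : C(ℝ≥0, ℝ) | pathExitTime a b p ≠ ⊤ ∧ pathExitValue a b p = a} with hL
  set R := {p : C(ℝ≥0, ℝ) | pathExitTime a b p ≠ ⊤ ∧ pathExitValue a b p = b} with hR
  have hdisj : Disjoint L R := by
    rw [Set.disjoint_left]
    rintro p ⟨-, hpa⟩ ⟨-, hpb⟩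
    rw [hpa] at hpb
    exact (ha.trans hb).ne hpb
  have hae : (fun p ↦ f (pathExitValue a b p)) =ᵐ[wienerLawC]
      fun p ↦ L.indicator (fun _ ↦ f a) p + R.indicator (fun _ ↦ f b) p := by
    filter_upwards [ae_pathExitValue_eq_or_eq_wienerLawC ha hb] with p hp
    rcases hp.2 with h | h
    · have hpL : p ∈ L := ⟨hp.1, h⟩
      rw [indicator_of_mem hpL, indicator_of_notMem (Set.disjoint_left.1 hdisj hpL), add_zero, h]
    · have hpR : p ∈ R := ⟨hp.1, h⟩
      rw [indicator_of_notMem (Set.disjoint_right.1 hdisj hpR), indicator_of_mem hpR, zero_add, h]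
  rw [integral_congr_ae hae,
    integral_add ((integrable_const _).indicator (measurableSet_pathExitLeft a b))
      ((integrable_const _).indicator (measurableSet_pathExitRight a b)),
    integral_indicator_const _ (measurableSet_pathExitLeft a b),
    integral_indicator_const _ (measurableSet_pathExitRight a b),
    wienerLawC_real_exitLeft ha hb, wienerLawC_real_exitRight ha hb]
  have hab : b - a ≠ 0 := by linarith
  simp only [smul_eq_mul]
  field_simp
  ring

/-- **`E[p(T)²] = -ab`** under the Wiener law (`a < 0 < b`). Durrett (2019), Thm. 7.5.5.
[cite: Durrett2019, Thm. 7.5.5] -/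
theorem integral_pathExitValue_sq_wienerLawC (ha : a < 0) (hb : 0 < b) :
    ∫ p, pathExitValue a b p ^ 2 ∂wienerLawC = -(a * b) := by
  rw [integral_comp_pathExitValue_wienerLawC ha hb (fun x ↦ x ^ 2)]
  have hab : b - a ≠ 0 := by linarith
  field_simp
  ring

/-- The real exit time is integrable under the Wiener law (`a < 0 < b`). [folklore] -/
theorem integrable_pathExitTimeReal_wienerLawC (ha : a < 0) (hb : 0 < b) :
    Integrable (pathExitTimeReal a b) wienerLawC := by
  rw [wienerLawC, integrable_map_measure (measurable_pathExitTimeReal a b).aestronglyMeasurable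
    measurable_brownianPathC.aemeasurable]
  exact integrable_brownianExitTimeReal ha hb

/-- The square of the real exit time is integrable under the Wiener law (`a < 0 < b`).
[folklore] -/
theorem integrable_pathExitTimeReal_sq_wienerLawC (ha : a < 0) (hb : 0 < b) :
    Integrable (fun p ↦ pathExitTimeReal a b p ^ 2) wienerLawC := by
  rw [wienerLawC, integrable_map_measure
    ((measurable_pathExitTimeReal a b).pow_const 2).aestronglyMeasurable
    measurable_brownianPathC.aemeasurable]
  exact integrable_brownianExitTimeReal_sq ha hb

/-- The square of the exit value is integrable under the Wiener law (it is bounded a.e.).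
[folklore] -/
theorem integrable_pathExitValue_sq_wienerLawC (ha : a < 0) (hb : 0 < b) :
    Integrable (fun p ↦ pathExitValue a b p ^ 2) wienerLawC := by
  refine (integrable_const (max (a ^ 2) (b ^ 2))).mono'
    ((measurable_pathExitValue a b).pow_const 2).aestronglyMeasurable ?_
  filter_upwards [ae_pathExitValue_eq_or_eq_wienerLawC ha hb] with p hp
  rw [Real.norm_eq_abs, abs_of_nonneg (sq_nonneg _)]
  rcases hp.2 with h | h
  · rw [h]; exact le_max_left _ _
  · rw [h]; exact le_max_right _ _

/-- **`E[T] = -ab`** under the Wiener law (`a < 0 < b`). Durrett (2019), Thm. 7.5.5.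
[cite: Durrett2019, Thm. 7.5.5] -/
theorem integral_pathExitTimeReal_wienerLawC (ha : a < 0) (hb : 0 < b) :
    ∫ p, pathExitTimeReal a b p ∂wienerLawC = -(a * b) := by
  rw [integral_wienerLawC (measurable_pathExitTimeReal a b).aestronglyMeasurable]
  exact integral_brownianExitTimeReal ha hb

/-- **`E[T - p(T)²] = 0`** under the Wiener law (`a < 0 < b`): the compensator identity behind
"`E[τ_{n+1} - τ_n | B[0,τ_n]] = E[(B_{τ_{n+1}} - B_{τ_n})² | B[0,τ_n]]`" of Lawler–Schramm–Werner
(2004), Lemma 3.8 (Durrett (2019), Thm. 8.1.1: `ET = -ab = EB_T²`).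
[cite: LawlerSchrammWerner2004, Lemma 3.8] -/
theorem integral_pathExitTimeReal_sub_sq_wienerLawC (ha : a < 0) (hb : 0 < b) :
    ∫ p, (pathExitTimeReal a b p - pathExitValue a b p ^ 2) ∂wienerLawC = 0 := by
  rw [integral_sub (integrable_pathExitTimeReal_wienerLawC ha hb)
    (integrable_pathExitValue_sq_wienerLawC ha hb), integral_pathExitTimeReal_wienerLawC ha hb,
    integral_pathExitValue_sq_wienerLawC ha hb, sub_self]

/-- **`E[T²] ≤ 2/(1-θ₀)² (b-a)⁴`** under the Wiener law (`a < 0 < b`), `θ₀ = P[|N(0,1)| < 1]`.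
Lawler–Schramm–Werner (2004), proof of Thm. 3.7 ("`E[(τ_{n+1}-τ_n)² | B[0,τ_n]] = O(δ⁴)`").
[cite: LawlerSchrammWerner2004, Lemma 3.8] -/
theorem integral_pathExitTimeReal_sq_wienerLawC_le (ha : a < 0) (hb : 0 < b) :
    ∫ p, pathExitTimeReal a b p ^ 2 ∂wienerLawC ≤
      2 / (1 - (gaussianReal 0 1).real (Ioo (-1) 1)) ^ 2 * (b - a) ^ 4 := by
  rw [integral_wienerLawC ((measurable_pathExitTimeReal a b).pow_const 2).aestronglyMeasurable]
  exact integral_brownianExitTimeReal_sq_le ha hb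

/-! ### The strong Markov property at the exit time, on path space -/

/-- The pull-back of the Borel σ-algebra of `C(ℝ≥0, ℝ)` under the path lift of a
continuous-path process is the pull-back of the product σ-algebra under the process (the
Borel σ-algebra is generated by the evaluations). [folklore] -/
theorem comap_toPathC_eq {Ω : Type*} (Y : ℝ≥0 → Ω → ℝ) (hY : ∀ ω, Continuous fun t ↦ Y t ω) :
    MeasurableSpace.comap (toPathC Y hY) ‹MeasurableSpace C(ℝ≥0, ℝ)› =
      MeasurableSpace.comap (fun ω t ↦ Y t ω) MeasurableSpace.pi := by
  have hB : ‹MeasurableSpace C(ℝ≥0, ℝ)› =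
      MeasurableSpace.pi.comap fun (f : C(ℝ≥0, ℝ)) (a : ℝ≥0) ↦ f a := by
    rw [← Process.iSup_comap_eval_eq_comap_pi, ← Process.borel_continuousMap_eq_iSup_comap_eval]
    exact BorelSpace.measurable_eq
  rw [hB, MeasurableSpace.comap_comp]
  rfl

/-- **Strong Markov at the exit time, law**: the post-exit path of the Brownian path has the
law of the Brownian path (`a < 0 < b`). From `identDistrib_brownianIncrAfter`
(Le Gall (2016), Thm. 2.20) and the transfer lemma `identDistrib_toPathC`.
[cite: Legall2016, Thm. 2.20] -/
theorem identDistrib_postExitPath_brownianPathC (ha : a < 0) (hb : 0 < b) :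
    IdentDistrib (fun ω ↦ postExitPath a b (brownianPathC ω)) brownianPathC
      Process.preWienerMeasure Process.preWienerMeasure := by
  have hσ := isStoppingTime_exitTime_brownian a b
  have h := identDistrib_brownianIncrAfter hσ (ae_exitTime_brownian_ne_top ha hb)
  have hlift := identDistrib_toPathC
    (Y := fun t ω ↦ brownianIncrAfter (Process.exitTime Process.brownian a b) t ω)
    (Y' := Process.brownian)
    (fun ω ↦ continuous_brownianIncrAfter _ ω) Process.continuous_brownian
    (fun t ↦ measurable_brownianIncrAfter hσ.measurable' t) Process.measurable_brownian h
  have heq : toPathC (fun t ω ↦ brownianIncrAfter (Process.exitTime Process.brownian a b) t ω)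
      (fun ω ↦ continuous_brownianIncrAfter _ ω) = fun ω ↦ postExitPath a b (brownianPathC ω) := by
    funext ω
    ext u
    rfl
  rwa [heq] at hlift

/-- **Strong Markov at the exit time, law on path space**: the Wiener law is invariant under
the post-exit map, `wienerLawC.map (postExitPath a b) = wienerLawC` (`a < 0 < b`). Durrett
(2019), proof of Thm. 8.2.1. [cite: Legall2016, Thm. 2.20] -/
theorem map_postExitPath_wienerLawC (ha : a < 0) (hb : 0 < b) :
    wienerLawC.map (postExitPath a b) = wienerLawC := by
  rw [wienerLawC, Measure.map_map (measurable_postExitPath a b) measurable_brownianPathC]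
  exact (identDistrib_postExitPath_brownianPathC ha hb).map_eq

/-- The pair (exit time, pre-exit path) of the Brownian path is measurable with respect to the
stopped σ-algebra `𝓕ᵂ_T` of the exit time. [folklore] -/
theorem measurable_exitData_stoppedSigma (a b : ℝ) :
    Measurable[(isStoppingTime_exitTime_brownian a b).measurableSpace]
      (fun ω ↦ (Process.exitTime Process.brownian a b ω, preExitPath a b (brownianPathC ω))) := by
  have hσ := isStoppingTime_exitTime_brownian a b
  refine hσ.measurable.prodMk ?_
  -- each coordinate of the stopped path is `𝓕ᵂ_{T ∧ u}`-, hence `𝓕ᵂ_T`-measurable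
  have hprog := StronglyAdapted.isStronglyProgressive_of_continuous stronglyAdapted_brownian
    Process.continuous_brownian
  refine measurable_toPathC (mΩ := hσ.measurableSpace)
    (Y := fun u ω ↦ stoppedProcess Process.brownian (Process.exitTime Process.brownian a b) u ω)
    (fun ω ↦ (Process.continuous_brownian ω).comp (Process.continuous_untopA_min_coe _)) ?_
  intro u
  have hmin : IsStoppingTime brownianFiltration
      (fun ω ↦ min (Process.exitTime Process.brownian a b ω) (u : WithTop ℝ≥0)) := hσ.min_const u
  have h1 : Measurable[hmin.measurableSpace] (stoppedValue Process.brownian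
      fun ω ↦ min (Process.exitTime Process.brownian a b ω) (u : WithTop ℝ≥0)) :=
    measurable_stoppedValue hprog hmin
  have hle : hmin.measurableSpace ≤ hσ.measurableSpace :=
    IsStoppingTime.measurableSpace_mono hmin hσ fun ω ↦ min_le_left _ _
  have h2 := h1.mono hle le_rfl
  have heq : (stoppedValue Process.brownian
      fun ω ↦ min (Process.exitTime Process.brownian a b ω) (u : WithTop ℝ≥0)) =
      fun ω ↦ stoppedProcess Process.brownian (Process.exitTime Process.brownian a b) u ω := by
    funext ω
    simp only [stoppedProcess_eq_stoppedValue_apply, stoppedValue, min_comm]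
  rwa [heq] at h2

/-- **Strong Markov at the exit time, independence**: the post-exit path of the Brownian path is
independent of the pair (exit time, pre-exit path) (`a < 0 < b`). From `indep_brownianIncrAfter`
(Le Gall (2016), Thm. 2.20: `Z^T` is independent of `𝓕ᵂ_T`). [cite: Legall2016, Thm. 2.20] -/
theorem indepFun_postExitPath_brownianPathC (ha : a < 0) (hb : 0 < b) :
    IndepFun (fun ω ↦ postExitPath a b (brownianPathC ω))
      (fun ω ↦ (Process.exitTime Process.brownian a b ω, preExitPath a b (brownianPathC ω)))
      Process.preWienerMeasure := by
  have hσ := isStoppingTime_exitTime_brownian a b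
  have h := indepFun_brownianIncrAfter hσ (ae_exitTime_brownian_ne_top ha hb)
    (measurable_exitData_stoppedSigma a b)
  -- replace the product σ-algebra pulled back by `Z^T` by the Borel one pulled back by its lift
  rw [IndepFun_iff_Indep] at h ⊢
  have hcomap := comap_toPathC_eq
    (Y := fun t ω ↦ brownianIncrAfter (Process.exitTime Process.brownian a b) t ω)
    (fun ω ↦ continuous_brownianIncrAfter _ ω)
  have heq : toPathC (fun t ω ↦ brownianIncrAfter (Process.exitTime Process.brownian a b) t ω)
      (fun ω ↦ continuous_brownianIncrAfter _ ω) = fun ω ↦ postExitPath a b (brownianPathC ω) := by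
    funext ω
    ext u
    rfl
  rw [heq] at hcomap
  rwa [hcomap]

/-- **Strong Markov at the exit time, on path space**: under the Wiener law the post-exit path
is independent of the pair (exit time, pre-exit path) (`a < 0 < b`) — "conditionally on `𝓕_T`
the increments after `T` are a fresh Brownian motion". Durrett (2019), proof of Thm. 8.2.1.
[cite: Legall2016, Thm. 2.20] -/
theorem indepFun_postExitPath_wienerLawC (ha : a < 0) (hb : 0 < b) :
    IndepFun (postExitPath a b) (fun p ↦ (pathExitTime a b p, preExitPath a b p)) wienerLawC := by
  haveI := isProbabilityMeasure_preWienerMeasure'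
  have h := indepFun_postExitPath_brownianPathC ha hb
  have hf : Measurable (postExitPath a b) := measurable_postExitPath a b
  have hg : Measurable (fun p : C(ℝ≥0, ℝ) ↦ (pathExitTime a b p, preExitPath a b p)) :=
    (measurable_pathExitTime a b).prodMk (measurable_preExitPath a b)
  rw [indepFun_iff_map_prod_eq_prod_map_map hf.aemeasurable hg.aemeasurable, wienerLawC,
    Measure.map_map (hf.prodMk hg) measurable_brownianPathC, Measure.map_map hf measurable_brownianPathC,
    Measure.map_map hg measurable_brownianPathC]
  exact (indepFun_iff_map_prod_eq_prod_map_map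
    (f := fun ω ↦ postExitPath a b (brownianPathC ω))
    (g := fun ω ↦ (Process.exitTime Process.brownian a b ω, preExitPath a b (brownianPathC ω)))
    (hf.comp measurable_brownianPathC).aemeasurable
    (hg.comp measurable_brownianPathC).aemeasurable).1 h

end PathLaw

end Literature.Probability.RandomPlanarGeometry
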